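import Summits.QuantumFields.QCD.Theses.CounterexampleMustBeHot

/-!
# `CounterexampleMustBeHot.ChiralColdCertificateOfSplit` (support item stmt-QuantumFields-18920) — the glue of
# the typed decomposition of the deciding crux `ChiralColdCertificate` (stmt-QuantumFields-17303)

Crux-strategist `cstrat-stmt-QuantumFields-17303-r1` (planner), 2026-08-17; BC2 redirect of the RESTATED deciding
crux of route `CounterexampleMustBeHot`.

`ChiralColdCertificate` bundles, about ONE regularisation, THERMODYNAMIC clauses (existence of the limits
`Lim`; the one-temperature aspect-`≥ 1` cold certificate `ColdFin` at `T₁(m)` for every positive mass tuple)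
and the SPECTRAL clause `reg.IsChiralAtZero` of the re-typed conjunct. The decomposition un-mixes the two
languages:

* `ColdHotWitness` (stmt-QuantumFields-18758, ∃, thermodynamic only): one regularisation (`β_k ≥ 0`,
  `m_crit(k) > −1` at every `k`) that is COLD at `T₁(m)` for every `m > 0` and `θ`-HOT at every temperature
  near the chiral limit, both clauses universal over the limit functions;
* `FreeEnergyLimits` (stmt-QuantumFields-18759, ∀): the thermodynamic and zero-temperature limits of the
  thermal free energy per site exist for every scheme with `β_k ≥ 0` and bare masses `> −1`;
* `GapImpliesCold` (stmt-QuantumFields-18760, ∀): a uniform lattice gap `ε` forces `θ`-coldness at every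
  `T ≤ c(reg, θ)·ε`.

This file proves the glue item BY NAME.  Three clauses of the parent are DERIVED rather than copied:
the physical-branch clause (from `m_crit(k) > −1` and `a_k m_f / Z_m(k) > 0`), the `Lim` clause
(instantiating `FreeEnergyLimits`), and `IsChiralAtZero` (contraposition through the quantitative
dictionary: with `T := c·ε`, a uniform gap `ε` at the `θ`-hot tuple `m(cε)` would make the d.o.f. count
eventually `≤ θ/2` while it is frequently `≥ θ`).

Pure theorem file over the route decls; no definitions, no analysis.  Tree copy under the crux directory
(namespace `…Cruxes.ChiralColdCertificate.Split`, so that a prover landing the same proof under `Theorems/`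
meets no name clash); the `Theorems/` target `CounterexampleMustBeHotChiralColdCertificateOfSplit.lean` is
prover-only (D-0016) and the identical file is attached as evidence on stmt-QuantumFields-18920.
-/

namespace Summit.QuantumFields.QCD.Cruxes.ChiralColdCertificate.Split

open Summit.QuantumFields.QCD.Theses.CounterexampleMustBeHot (ColdHotWitness FreeEnergyLimits GapImpliesCold
  ChiralColdCertificate ChiralColdCertificateOfSplit)

/-- **Glue of the decomposition (item stmt-QuantumFields-18920, BY NAME):**
`ColdHotWitness → FreeEnergyLimits → GapImpliesCold → ChiralColdCertificate`. [folklore] -/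
theorem chiralColdCertificateOfSplit_proof : ChiralColdCertificateOfSplit := by
  intro h₁ h₂ h₃ Nf hNf
  obtain ⟨reg, hms, has, hβ, hcrit, hcold, θ, hθ, hhot⟩ := h₁ Nf hNf
  -- (i) the bare trajectory of every positive tuple stays on the physical branch at EVERY k
  have hbranch : ∀ m : Fin Nf → ℝ, (∀ fl, 0 < m fl) →
      ∀ (fl : Fin Nf) (k : ℕ), -1 < (reg.scheme m 0 0).mq fl k := by
    intro m hm fl k
    rw [Literature.MathematicalPhysics.QuantumFieldTheory.QCDRegularisation.scheme_mq]
    have hpos : 0 < reg.a k * m fl / reg.Zm k :=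
      div_pos (mul_pos (reg.a_pos k) (hm fl)) (reg.Zm_pos k)
    linarith [hcrit k]
  refine ⟨reg, hms, ?_, has, fun m hm => ?_⟩
  · -- (ii) chirality at zero: a uniform gap ε would make the theory cold at T = c ε (GapImpliesCold),
    --      contradicting the heat certified near the chiral limit (ColdHotWitness) once limits exist
    intro ε hε
    obtain ⟨c, hc, hgapcold⟩ := h₃ Nf hNf reg hms has (θ / 2) (half_pos hθ)
    obtain ⟨m, hm, hhotm⟩ := hhot (c * ε) (mul_pos hc hε)
    refine ⟨m, hm, fun hgap => ?_⟩
    obtain ⟨φ, e₀, hφ⟩ := h₂ Nf hNf (reg.scheme m 0 0) hβ (hbranch m hm)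
    have hfreq := hhotm φ e₀ hφ
    have hev := hgapcold m hm (fun fl => Filter.Eventually.of_forall (hbranch m hm fl)) ε hε hgap φ e₀ hφ
      (c * ε) (mul_pos hc hε) le_rfl
    obtain ⟨k, hk₁, hk₂⟩ := (hfreq.and_eventually hev).exists
    linarith
  · -- (iii) the certificate at the positive tuple m: branch (i), limits (FreeEnergyLimits), coldness
    obtain ⟨φ, e₀, hφ⟩ := h₂ Nf hNf (reg.scheme m 0 0) hβ (hbranch m hm)
    obtain ⟨η, hη, T₁, hT₁, hc⟩ := hcold m hm
    exact ⟨fun fl => Filter.Eventually.of_forall (hbranch m hm fl), φ, e₀, hφ, η, hη, T₁, hT₁, hc φ e₀ hφ⟩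

/-- The decomposition in item vocabulary with the arrows unfolded: from the three pieces, the parent crux
`ChiralColdCertificate` (stmt-QuantumFields-17303). [folklore] -/
theorem chiralColdCertificate_of_pieces (h₁ : ColdHotWitness) (h₂ : FreeEnergyLimits) (h₃ : GapImpliesCold) :
    ChiralColdCertificate :=
  chiralColdCertificateOfSplit_proof h₁ h₂ h₃

end Summit.QuantumFields.QCD.Cruxes.ChiralColdCertificate.Split
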